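/- Free-seat work of LEAD seat `ym-line-cbag-p1` (prover-ym-line-cbag-p1-g22-0; own crux stmt-QuantumFields-22254 closed) on the
planner-of-record's LINE 7, route `GlueballBandRecursion` (cruxes stmt-QuantumFields-27506/27507/27508): a ROUTE-INDEPENDENT toolkit
for the finite-volume rate `q_N(β) = ⨅ₖ x_{k+2}(N)^{1/(k+2)}` in which all three cruxes are typed. -/
import Summits.QuantumFields.YangMills.Theorems.DoublingDefectRecursionToGapSpectral
import Literature.MathematicalPhysics.QuantumFieldTheory.Balaban1983to89.InfiniteVolumeSufficientXII

/-!
# The finite-volume rate `q_N = ⨅ₖ x_{k+2}(N)^{1/(k+2)}` of the Wilson torus transfer matrix IS the top excited ratio `λ₁/λ₀`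

Route `GlueballBandRecursion` types its three cruxes (K1 `GapStableUnderRefinement`, K2 `ThermalMultiplicityUpper`,
K3 `OneGlueballBandLower`) over the thermal trace excess `x_t(N) = traceExcess ρ β N t = Z(N³×t)/λ₊^t − 1 = Σ_{i ≠ i₀} rᵢ^t`
(`rᵢ = λᵢ/λ₊ ∈ [0,1]`, tree: `DoublingDefect.exists_ratios_hasSum_traceExcess`) and the rate
`q_N := ⨅ k, x_{k+2}(N)^{1/(k+2)}`.  This file is the kernel version of the critic's typing read-back (idea-crit-4, verdict of
2026-08-28T10:49Z): for continuous unitary `ρ` on a compact metrisable group and `β ≥ 0`,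

* `traceExcess_nonneg`       — `0 ≤ x_{m+2}(N)`;
* `rate_nonneg`, `rate_le_rpow`, `rate_pow_le_traceExcess` — `0 ≤ q_N ≤ x_{m+2}^{1/(m+2)}`, i.e. the ONE-STATE FLOOR
  `q_N^{m+2} ≤ x_{m+2}(N)` for every `m`;
* `exists_ratios_rate` — the spectral package WITH the rate: every excited ratio satisfies `rᵢ ≤ q_N`, and `q_N` is the LEAST
  `b ≥ 0` dominating all excited ratios (so `q_N = sup_{i ≠ i₀} rᵢ = λ₁/λ₀`, and `q_N = 0` iff the normalised transfer
  semigroup has rank one); with the CEILING `x_{m+2}(N) ≤ q_N^m · x_2(N)`;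
* `traceExcess_small_of_large` — uniform window smallness: for every `ε > 0` there is `L₁` with `x_{⌊L/4⌋}(L) ≤ ε` for all
  `L ≥ L₁` and ALL `0 ≤ β ≤ strongCouplingRadius ρ` (tree `traceExcess_le_of_strongCoupling` + `L⁴e^{−L/8} → 0`), whence
  `q_L ≤ 1` there (`rate_le_one_of_traceExcess_le_one`).

No `Theses` file is imported (the statements are about tree objects only), so stub files of K1/K2/K3 can build on this module
without entering a route cone.

HONEST FRAMING.  Elementary spectral bookkeeping; nothing here is a statement about one-glueball bands, thermal multiplicities
or finite-size stability (the cruxes), about the rung `ColdDoublingRecursionStrongCoupling`, or about the Yang–Mills mass gap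
(Clay), none of which is proved by anything in this file.
-/

set_option autoImplicit false

noncomputable section

open Filter Topology
open Literature.MathematicalPhysics.QuantumFieldTheory
open Literature.MathematicalPhysics.QuantumFieldTheory.Balaban1983to89.Missing (strongCouplingRadius
  traceExcess_le_of_strongCoupling)
open Summit.QuantumFields.YangMills.Theorems.DoublingDefect (exists_ratios_hasSum_traceExcess)

namespace Summit.QuantumFields.YangMills.Theorems.GlueballBandRecursion.Rate

variable {G : Type} [Group G] [TopologicalSpace G] [IsTopologicalGroup G] [CompactSpace G]
  [MeasurableSpace G] [BorelSpace G] [SecondCountableTopology G] {n : ℕ} {ρ : G →* Matrix (Fin n) (Fin n) ℂ}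

/-- **The thermal trace excess is non-negative**: `0 ≤ x_{m+2}(N) = Σ_{i ≠ i₀} rᵢ^{m+2}` (`β ≥ 0`, continuous unitary `ρ`). -/
theorem traceExcess_nonneg (hρ : Continuous ρ) (hρu : ∀ g, ρ g ∈ Matrix.unitaryGroup (Fin n) ℂ)
    {β : ℝ} (hβ : 0 ≤ β) (N m : ℕ) [NeZero N] : 0 ≤ traceExcess ρ β N (m + 2) := by
  obtain ⟨ι, _, r, i₀, hr, -, -, -, hx⟩ := exists_ratios_hasSum_traceExcess hρ hρu hβ N
  refine (hx m).nonneg fun i => ?_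
  rcases eq_or_ne i i₀ with h | h
  · simp [h]
  · simp [Function.update_of_ne h, pow_nonneg (hr i).1]

/-- **The rate is non-negative**: `0 ≤ q_N`. -/
theorem rate_nonneg (hρ : Continuous ρ) (hρu : ∀ g, ρ g ∈ Matrix.unitaryGroup (Fin n) ℂ)
    {β : ℝ} (hβ : 0 ≤ β) (N : ℕ) [NeZero N] :
    0 ≤ ⨅ k : ℕ, traceExcess ρ β N (k + 2) ^ ((1 : ℝ) / ((k : ℝ) + 2)) :=
  Real.iInf_nonneg fun k => Real.rpow_nonneg (traceExcess_nonneg hρ hρu hβ N k) _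

/-- The family `k ↦ x_{k+2}(N)^{1/(k+2)}` is bounded below (by `0`). -/
theorem rate_bddBelow (hρ : Continuous ρ) (hρu : ∀ g, ρ g ∈ Matrix.unitaryGroup (Fin n) ℂ)
    {β : ℝ} (hβ : 0 ≤ β) (N : ℕ) [NeZero N] :
    BddBelow (Set.range fun k : ℕ => traceExcess ρ β N (k + 2) ^ ((1 : ℝ) / ((k : ℝ) + 2))) :=
  ⟨0, by rintro _ ⟨k, rfl⟩; exact Real.rpow_nonneg (traceExcess_nonneg hρ hρu hβ N k) _⟩

/-- **The rate is below every root**: `q_N ≤ x_{m+2}(N)^{1/(m+2)}`. -/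
theorem rate_le_rpow (hρ : Continuous ρ) (hρu : ∀ g, ρ g ∈ Matrix.unitaryGroup (Fin n) ℂ)
    {β : ℝ} (hβ : 0 ≤ β) (N m : ℕ) [NeZero N] :
    (⨅ k : ℕ, traceExcess ρ β N (k + 2) ^ ((1 : ℝ) / ((k : ℝ) + 2))) ≤
      traceExcess ρ β N (m + 2) ^ ((1 : ℝ) / ((m : ℝ) + 2)) :=
  ciInf_le (rate_bddBelow hρ hρu hβ N) m

/-- **One-state floor**: `q_N^{m+2} ≤ x_{m+2}(N)` for every `m` (the top excited state alone). -/
theorem rate_pow_le_traceExcess (hρ : Continuous ρ) (hρu : ∀ g, ρ g ∈ Matrix.unitaryGroup (Fin n) ℂ)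
    {β : ℝ} (hβ : 0 ≤ β) (N m : ℕ) [NeZero N] :
    (⨅ k : ℕ, traceExcess ρ β N (k + 2) ^ ((1 : ℝ) / ((k : ℝ) + 2))) ^ (m + 2) ≤ traceExcess ρ β N (m + 2) := by
  have hx0 := traceExcess_nonneg hρ hρu hβ N m
  have hq0 := rate_nonneg hρ hρu hβ N
  have h1 := rate_le_rpow hρ hρu hβ N m
  have hexp : (1 : ℝ) / ((m : ℝ) + 2) = ((m + 2 : ℕ) : ℝ)⁻¹ := by push_cast; rw [one_div]
  calc (⨅ k : ℕ, traceExcess ρ β N (k + 2) ^ ((1 : ℝ) / ((k : ℝ) + 2))) ^ (m + 2)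
      ≤ (traceExcess ρ β N (m + 2) ^ ((1 : ℝ) / ((m : ℝ) + 2))) ^ (m + 2) := pow_le_pow_left₀ hq0 h1 _
    _ = traceExcess ρ β N (m + 2) := by
        rw [hexp]; exact Real.rpow_inv_natCast_pow hx0 (by omega)

/-- If `x_{m+2}(N) ≤ 1` for some `m` then `q_N ≤ 1`. -/
theorem rate_le_one_of_traceExcess_le_one (hρ : Continuous ρ) (hρu : ∀ g, ρ g ∈ Matrix.unitaryGroup (Fin n) ℂ)
    {β : ℝ} (hβ : 0 ≤ β) (N m : ℕ) [NeZero N] (h1 : traceExcess ρ β N (m + 2) ≤ 1) :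
    (⨅ k : ℕ, traceExcess ρ β N (k + 2) ^ ((1 : ℝ) / ((k : ℝ) + 2))) ≤ 1 :=
  (rate_le_rpow hρ hρu hβ N m).trans (Real.rpow_le_one (traceExcess_nonneg hρ hρu hβ N m) h1 (by positivity))

/-- **The spectral package with the rate.**  For `β ≥ 0` and continuous unitary `ρ` there are ratios `rᵢ ∈ [0,1]` with
`r_{i₀} = 1` and `Σ_{i ≠ i₀} rᵢ^{m+2} = x_{m+2}(N)` (tree), and for THESE ratios: every excited ratio is at most the rate,
`rᵢ ≤ q_N` (`i ≠ i₀`); the rate is the LEAST non-negative bound of the excited ratios (`rᵢ ≤ b` for all `i ≠ i₀`, `b ≥ 0`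
`⟹ q_N ≤ b`) — so `q_N = λ₁/λ₀`; and the ceiling `x_{m+2}(N) ≤ q_N^m · x_2(N)`. -/
theorem exists_ratios_rate (hρ : Continuous ρ) (hρu : ∀ g, ρ g ∈ Matrix.unitaryGroup (Fin n) ℂ)
    {β : ℝ} (hβ : 0 ≤ β) (N : ℕ) [NeZero N] :
    ∃ (ι : Type) (_ : DecidableEq ι) (r : ι → ℝ) (i₀ : ι), (∀ i, 0 ≤ r i ∧ r i ≤ 1) ∧ r i₀ = 1 ∧
      (∀ m : ℕ, HasSum (Function.update (fun i => r i ^ (m + 2)) i₀ 0) (traceExcess ρ β N (m + 2))) ∧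
      (∀ i, i ≠ i₀ → r i ≤ ⨅ k : ℕ, traceExcess ρ β N (k + 2) ^ ((1 : ℝ) / ((k : ℝ) + 2))) ∧
      (∀ b : ℝ, 0 ≤ b → (∀ i, i ≠ i₀ → r i ≤ b) →
        (∀ m : ℕ, traceExcess ρ β N (m + 2) ≤ b ^ m * traceExcess ρ β N 2) ∧
        (⨅ k : ℕ, traceExcess ρ β N (k + 2) ^ ((1 : ℝ) / ((k : ℝ) + 2))) ≤ b) ∧
      (∀ m : ℕ, traceExcess ρ β N (m + 2) ≤
        (⨅ k : ℕ, traceExcess ρ β N (k + 2) ^ ((1 : ℝ) / ((k : ℝ) + 2))) ^ m * traceExcess ρ β N 2) := by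
  obtain ⟨ι, _, r, i₀, hr, hri₀, -, -, hx⟩ := exists_ratios_hasSum_traceExcess hρ hρu hβ N
  set q : ℝ := ⨅ k : ℕ, traceExcess ρ β N (k + 2) ^ ((1 : ℝ) / ((k : ℝ) + 2)) with hqdef
  -- the terms of the excited sums are non-negative
  have hterm0 : ∀ m i, 0 ≤ Function.update (fun i => r i ^ (m + 2)) i₀ 0 i := by
    intro m i
    rcases eq_or_ne i i₀ with h | h
    · simp [h]
    · simp [Function.update_of_ne h, pow_nonneg (hr i).1]
  -- each excited ratio power is below the excess: `rᵢ^{m+2} ≤ x_{m+2}`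
  have hri : ∀ i, i ≠ i₀ → ∀ m : ℕ, r i ^ (m + 2) ≤ traceExcess ρ β N (m + 2) := by
    intro i hi m
    have h := le_hasSum (hx m) i fun j _ => hterm0 m j
    simpa [Function.update_of_ne hi] using h
  -- hence `rᵢ ≤ q`
  have hriq : ∀ i, i ≠ i₀ → r i ≤ q := by
    intro i hi
    refine le_ciInf fun k => ?_
    have hk : (1 : ℝ) / ((k : ℝ) + 2) = ((k + 2 : ℕ) : ℝ)⁻¹ := by push_cast; rw [one_div]
    calc r i = (r i ^ (k + 2)) ^ ((1 : ℝ) / ((k : ℝ) + 2)) := by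
          rw [hk]; exact (Real.pow_rpow_inv_natCast (hr i).1 (by omega)).symm
      _ ≤ traceExcess ρ β N (k + 2) ^ ((1 : ℝ) / ((k : ℝ) + 2)) :=
          Real.rpow_le_rpow (pow_nonneg (hr i).1 _) (hri i hi k) (by positivity)
  -- ceiling under a bound `b` of the excited ratios: `x_{m+2} ≤ b^m x_2`
  have hx2 : HasSum (Function.update (fun i => r i ^ 2) i₀ 0) (traceExcess ρ β N 2) := by
    simpa using hx 0
  have hceil : ∀ b : ℝ, 0 ≤ b → (∀ i, i ≠ i₀ → r i ≤ b) →
      ∀ m : ℕ, traceExcess ρ β N (m + 2) ≤ b ^ m * traceExcess ρ β N 2 := by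
    intro b hb hrb m
    have hle : ∀ i, Function.update (fun i => r i ^ (m + 2)) i₀ 0 i ≤
        b ^ m * Function.update (fun i => r i ^ 2) i₀ 0 i := by
      intro i
      rcases eq_or_ne i i₀ with h | h
      · simp [h]
      · simp only [Function.update_of_ne h]
        rw [pow_add]
        exact mul_le_mul_of_nonneg_right (pow_le_pow_left₀ (hr i).1 (hrb i h) m) (pow_nonneg (hr i).1 2)
    exact hasSum_le hle (hx m) (hx2.mul_left (b ^ m))
  -- least-bound property: `q ≤ b`
  have hleast : ∀ b : ℝ, 0 ≤ b → (∀ i, i ≠ i₀ → r i ≤ b) → q ≤ b := by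
    intro b hb hrb
    have hx20 : 0 ≤ traceExcess ρ β N 2 := by simpa using traceExcess_nonneg hρ hρu hβ N 0
    -- `q ≤ (b^m x_2)^{1/(m+2)} = b^{m/(m+2)} x_2^{1/(m+2)}` for every `m`
    have hqm : ∀ m : ℕ, q ≤ b ^ ((m : ℝ) / ((m : ℝ) + 2)) * traceExcess ρ β N 2 ^ ((1 : ℝ) / ((m : ℝ) + 2)) := by
      intro m
      have h1 : q ≤ traceExcess ρ β N (m + 2) ^ ((1 : ℝ) / ((m : ℝ) + 2)) := rate_le_rpow hρ hρu hβ N m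
      have h2 : traceExcess ρ β N (m + 2) ^ ((1 : ℝ) / ((m : ℝ) + 2)) ≤
          (b ^ m * traceExcess ρ β N 2) ^ ((1 : ℝ) / ((m : ℝ) + 2)) :=
        Real.rpow_le_rpow (traceExcess_nonneg hρ hρu hβ N m) (hceil b hb hrb m) (by positivity)
      have h3 : (b ^ m * traceExcess ρ β N 2) ^ ((1 : ℝ) / ((m : ℝ) + 2)) =
          b ^ ((m : ℝ) / ((m : ℝ) + 2)) * traceExcess ρ β N 2 ^ ((1 : ℝ) / ((m : ℝ) + 2)) := by
        rw [Real.mul_rpow (pow_nonneg hb m) hx20, ← Real.rpow_natCast b m, ← Real.rpow_mul hb]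
        congr 2
        field_simp
      linarith [h3 ▸ h2]
    -- the right-hand side tends to `b` (case `x_2 > 0`) or is `0` (case `x_2 = 0`)
    rcases hx20.eq_or_lt with hz | hpos
    · have h := hqm 1
      rw [← hz, Real.zero_rpow (by norm_num), mul_zero] at h
      exact h.trans hb
    · have hexp1 : Tendsto (fun m : ℕ => (m : ℝ) / ((m : ℝ) + 2)) atTop (𝓝 1) := tendsto_natCast_div_add_atTop 2
      have hexp0 : Tendsto (fun m : ℕ => (1 : ℝ) / ((m : ℝ) + 2)) atTop (𝓝 0) :=
        tendsto_const_nhds.div_atTop (tendsto_natCast_atTop_atTop.atTop_add tendsto_const_nhds)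
      have hb1 : Tendsto (fun m : ℕ => b ^ ((m : ℝ) / ((m : ℝ) + 2))) atTop (𝓝 (b ^ (1 : ℝ))) :=
        tendsto_const_nhds.rpow hexp1 (Or.inr one_pos)
      have hx1 : Tendsto (fun m : ℕ => traceExcess ρ β N 2 ^ ((1 : ℝ) / ((m : ℝ) + 2))) atTop
          (𝓝 (traceExcess ρ β N 2 ^ (0 : ℝ))) :=
        tendsto_const_nhds.rpow hexp0 (Or.inl hpos.ne')
      have hlim : Tendsto (fun m : ℕ => b ^ ((m : ℝ) / ((m : ℝ) + 2)) * traceExcess ρ β N 2 ^ ((1 : ℝ) / ((m : ℝ) + 2)))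
          atTop (𝓝 b) := by
        have h := hb1.mul hx1
        simpa [Real.rpow_one, Real.rpow_zero] using h
      exact ge_of_tendsto' hlim hqm
  exact ⟨ι, inferInstance, r, i₀, hr, hri₀, hx, hriq, fun b hb hrb => ⟨hceil b hb hrb, hleast b hb hrb⟩,
    hceil q (hqdef ▸ rate_nonneg hρ hρu hβ N) hriq⟩

/-- **Uniform smallness of the cold trace excess on the strong-coupling window**: for every `ε > 0` there is `L₁` with
`x_{⌊L/4⌋}(L) ≤ ε` for every `L ≥ L₁` (`⌊L/4⌋ = m + 2`) and ALL `0 ≤ β ≤ strongCouplingRadius ρ` — from the tree's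
`traceExcess_le_of_strongCoupling` (`x_{m+2}(L) ≤ exp(12L³(m+2)e^{−⌊(m+2)/2⌋}) − 1`) and `L⁴e^{−L/8} → 0`. -/
theorem traceExcess_small_of_large (hρ : Continuous ρ) (hρu : ∀ g, ρ g ∈ Matrix.unitaryGroup (Fin n) ℂ)
    {ε : ℝ} (hε : 0 < ε) :
    ∃ L₁ : ℕ, ∀ β : ℝ, 0 ≤ β → β ≤ strongCouplingRadius ρ →
      ∀ (L : ℕ) [NeZero L] (m : ℕ), L / 4 = m + 2 → L₁ ≤ L → traceExcess ρ β L (m + 2) ≤ ε := by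
  have ht : Tendsto (fun u : ℝ => u ^ 4 * Real.exp (-u)) atTop (𝓝 0) :=
    Real.tendsto_pow_mul_exp_neg_atTop_nhds_zero 4
  have hlog : 0 < Real.log (1 + ε) := Real.log_pos (by linarith)
  set η : ℝ := Real.log (1 + ε) / (3 * Real.exp 1 * 4096) with hη
  have hηpos : 0 < η := by positivity
  obtain ⟨X, hX⟩ := eventually_atTop.1 ((tendsto_order.1 ht).2 η hηpos)
  refine ⟨⌈8 * X⌉₊, fun β hβ0 hβ L _ m hm hL => ?_⟩
  have hmaj := traceExcess_le_of_strongCoupling ρ hρ hρu hβ0 hβ L m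
  have hk : (m + 2) / 2 = L / 8 := by omega
  have h8 : L ≤ 8 * (L / 8) + 7 := by omega
  have h4 : 4 * (m + 2) ≤ L := by omega
  set u : ℝ := (L : ℝ) / 8 with hu
  have huX : X ≤ u := by
    have h1 : (8 * X : ℝ) ≤ ⌈8 * X⌉₊ := Nat.le_ceil _
    have h2 : (⌈8 * X⌉₊ : ℝ) ≤ L := by exact_mod_cast hL
    rw [hu]; linarith
  have hu4 : u ^ 4 * Real.exp (-u) < η := hX u huX
  have hkR : -((((m + 2) / 2 : ℕ) : ℝ)) ≤ 1 + -u := by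
    rw [hk]
    have : (L : ℝ) ≤ 8 * ((L / 8 : ℕ) : ℝ) + 7 := by exact_mod_cast h8
    rw [hu]; linarith
  have hmR : (m : ℝ) + 2 ≤ 2 * u := by
    have : 4 * ((m : ℝ) + 2) ≤ L := by exact_mod_cast h4
    rw [hu]; linarith
  have hL3 : (L : ℝ) ^ 3 = 512 * u ^ 3 := by rw [hu]; ring
  have hexp : Real.exp (-((((m + 2) / 2 : ℕ) : ℝ))) ≤ Real.exp 1 * Real.exp (-u) := by
    rw [← Real.exp_add]; exact Real.exp_le_exp.2 hkR
  have hu0 : 0 ≤ u := by positivity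
  have hE : 12 * (L : ℝ) ^ 3 * ((m : ℝ) + 2) * Real.exp (-((((m + 2) / 2 : ℕ) : ℝ))) ≤ Real.log (1 + ε) := by
    calc 12 * (L : ℝ) ^ 3 * ((m : ℝ) + 2) * Real.exp (-((((m + 2) / 2 : ℕ) : ℝ)))
        ≤ 12 * (512 * u ^ 3) * (2 * u) * (Real.exp 1 * Real.exp (-u)) := by
          rw [hL3]
          exact mul_le_mul (mul_le_mul_of_nonneg_left hmR (by positivity)) hexp (by positivity) (by positivity)
      _ = 3 * Real.exp 1 * 4096 * (u ^ 4 * Real.exp (-u)) := by ring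
      _ ≤ 3 * Real.exp 1 * 4096 * η := mul_le_mul_of_nonneg_left hu4.le (by positivity)
      _ = Real.log (1 + ε) := by rw [hη]; field_simp
  calc traceExcess ρ β L (m + 2)
      ≤ Real.exp (12 * (L : ℝ) ^ 3 * ((m : ℝ) + 2) * Real.exp (-((((m + 2) / 2 : ℕ) : ℝ)))) - 1 := hmaj
    _ ≤ Real.exp (Real.log (1 + ε)) - 1 := by gcongr
    _ = ε := by rw [Real.exp_log (by linarith)]; ring

/-- On the strong-coupling window the rate is at most `1` for all large tori: `q_L ≤ 1` for `L ≥ L₁`, ALL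
`0 ≤ β ≤ strongCouplingRadius ρ`. -/
theorem rate_le_one_of_large (hρ : Continuous ρ) (hρu : ∀ g, ρ g ∈ Matrix.unitaryGroup (Fin n) ℂ) :
    ∃ L₁ : ℕ, ∀ β : ℝ, 0 ≤ β → β ≤ strongCouplingRadius ρ →
      ∀ (L : ℕ) [NeZero L], L₁ ≤ L →
        (⨅ k : ℕ, traceExcess ρ β L (k + 2) ^ ((1 : ℝ) / ((k : ℝ) + 2))) ≤ 1 := by
  obtain ⟨L₁, h⟩ := traceExcess_small_of_large hρ hρu one_pos
  refine ⟨max L₁ 8, fun β hβ0 hβ L _ hL => ?_⟩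
  obtain ⟨m, hm⟩ : ∃ m : ℕ, L / 4 = m + 2 := ⟨L / 4 - 2, by omega⟩
  exact rate_le_one_of_traceExcess_le_one hρ hρu hβ0 L m (h β hβ0 hβ L m hm (le_trans (le_max_left _ _) hL))

end Summit.QuantumFields.YangMills.Theorems.GlueballBandRecursion.Rate

end
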